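import Summits.AtomisticToContinuum.Crystallization.Theorems.ChartedPlanarOrderLayerChainLiouvilleTailL1

/-!
# The ℓ²-monotone («tube-convex») layer-chain Liouville kernel — E1′ of the PS column
(decomp-a2c lens-3 g24; critic row 458 (A) R1/R4: the scalar E1-dominance split `TubeMonotone ⟸ FarPairStiffnessL1 ∧ AdjacentPairDominance` is
RETIRED — the census found the scalar own-gap dominance `Σ'κ − κ 0 < λ` numerically false as typed on admissible stacked configurations
(TAG 161, W161.md e8d64cf4) — and the PIVOT OF RECORD is E1′ = GLOBAL ℓ²-MONOTONICITY on finitely supported differences + a DISCRETE LIOUVILLE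
theorem whose boundary terms are paid by the first moment `Σ' |j| κ j`.)

Setting (as in `…ChartedPlanarOrderLayerChainLiouvilleTailL1`, pure Mathlib): a real inner-product space `E`, stresses `Φ m : (ℤ → E) → E`
transmitted across gap `m` as functions of the whole increment profile, windows `W m ⊆ E`, summable cross-gap Lipschitz weights `κ ≥ 0` with
finite first moment, `‖Φ m h − Φ m h'‖ ≤ Σ'_j κ j ‖h (m+j) − h' (m+j)‖` on window profiles.  The monotonicity hypothesis is NEW:

* (conv) `λ · Σ_{m ∈ F} ‖h m − h' m‖² ≤ Σ_{m ∈ F} ⟪Φ m h − Φ m h', h m − h' m⟫` for every finite `F ⊆ ℤ` and every two window profiles that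
  AGREE OFF `F` — `λ`-strong monotonicity of the WHOLE gap-stress map on finitely supported differences (for a gradient map: uniform convexity
  of the interlayer energy on the window product), with NO relation between `λ` and `κ`.

PROVED here (sorry-free):
* `convex_block` — the CUT-OFF INEQUALITY: for window profiles `g, g'` with `‖g − g'‖ ≤ B` everywhere and `≤ β` off the block `[a, b]`,
  `λ Σ_{[a,b]} ‖d‖² ≤ B·β·Σ'|j|κ j + Σ_{[a,b]} ⟪Φ m g − Φ m g', d m⟫` (apply (conv) to the profile cut off to `g'` outside the block; the
  cut-off error is carried by at most `|j|` block members per coupling distance `j` — `card_filter_shift_not_mem_Icc_le`);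
* `convex_unique` — ★ DISCRETE LIOUVILLE: two window profiles with bounded difference and EQUAL stresses across every gap coincide
  (`β = B` gives a uniform block bound, hence `d → 0`; then `β → 0` on large blocks kills every single `‖d m₀‖²`);
* `convex_stress_eq` — bounded block sums of `d` (bounded relative OFFSETS) and constant stresses `σ, σ'` ⇒ `σ = σ'` (Tannery's theorem on
  `m ↦ Σ'_j κ j ‖d (m+j)‖`);
* ★ `convex_translation` — the ABSTRACT PS in ℓ²-monotone form = E1′ `SlavingKernelConvex` of `…ChartedPlanarOrderTubeConvex`, binder for
  binder: two balanced increment profiles in the windows whose offset profiles stay at bounded distance differ by a translation;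
* `convex_of_mono_dom` — the scalar data of E1 (own-increment `λ`-monotonicity + `Σ'κ − κ 0 < λ`) IMPLY (conv) with `λ − (Σ'κ − κ 0)`:
  E1′'s hypothesis is WEAKER than E1's (Young's inequality against the off-diagonal weights).
Pure Mathlib on top of the ℓ¹ kernel's helper lemmas; def-free; no instances, no notation; sorry-free.
-/

noncomputable section

open Filter Topology
open scoped RealInnerProductSpace
open Summit.AtomisticToContinuum.Crystallization.Theorems.ChartedPlanarOrderLayerChainLiouvilleTail (norm_sum_Icc_increments_le
  eventually_small_of_block_bound exists_translation_of_increments_eq ite_weight_nonneg ite_weight_le summable_ite_weight tsum_ite_weight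
  mul_tsum_le_young)

namespace Summit.AtomisticToContinuum.Crystallization.Theorems.ChartedPlanarOrderTubeConvexKernel

variable {E : Type*} [NormedAddCommGroup E] [InnerProductSpace ℝ E]

/-- at most `|j|` members of an integer block leave the block under the shift by `j`. -/
theorem card_filter_shift_not_mem_Icc_le (a b j : ℤ) :
    (((Finset.Icc a b).filter (fun m => m + j ∉ Finset.Icc a b)).card : ℝ) ≤ |(j : ℝ)| := by
  have hsub : (Finset.Icc a b).filter (fun m => m + j ∉ Finset.Icc a b) ⊆ Finset.Ioc (b - j) b ∪ Finset.Ico a (a - j) := by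
    intro m hm
    simp only [Finset.mem_filter, Finset.mem_Icc, Finset.mem_union, Finset.mem_Ioc, Finset.mem_Ico] at hm ⊢
    omega
  have h1 := (Finset.card_le_card hsub).trans (Finset.card_union_le _ _)
  rw [Int.card_Ioc, Int.card_Ico, show b - (b - j) = j by ring, show a - j - a = -j by ring,
    Int.toNat_add_toNat_neg_eq_natAbs] at h1
  have h2 : ((((Finset.Icc a b).filter (fun m => m + j ∉ Finset.Icc a b)).card : ℕ) : ℝ) ≤ (j.natAbs : ℝ) := by
    exact_mod_cast h1
  rwa [Nat.cast_natAbs, Int.cast_abs] at h2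

omit [InnerProductSpace ℝ E] in
/-- a uniform bound on the block sums `Σ_{[a,b]} ‖d m‖²` forces `‖d m‖ → 0` along the cofinite filter
(filter form of `…LayerChainLiouvilleTail.eventually_small_of_block_bound`). -/
theorem tendsto_norm_cofinite_of_block_bound (d : ℤ → E) {C : ℝ}
    (hC : ∀ a b : ℤ, ∑ m ∈ Finset.Icc a b, ‖d m‖ ^ 2 ≤ C) : Tendsto (fun m => ‖d m‖) cofinite (𝓝 0) := by
  rw [Metric.tendsto_nhds]
  intro ε hε
  obtain ⟨N, hN⟩ := eventually_small_of_block_bound (fun m => ‖d m‖) hC hε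
  rw [Filter.eventually_cofinite]
  refine (Set.finite_Icc (-(N : ℤ)) N).subset (fun m hm => ?_)
  by_contra hm'
  apply hm
  rw [Real.dist_0_eq_abs, abs_of_nonneg (norm_nonneg _)]
  refine hN m (lt_abs.2 ?_)
  rw [Set.mem_Icc, not_and_or, not_le, not_le] at hm'
  rcases hm' with h | h
  · exact Or.inr (by linarith)
  · exact Or.inl h

section Convex

variable (Φ : ℤ → (ℤ → E) → E) (W : ℤ → Set E) (κ : ℤ → ℝ)

/-- **The cut-off inequality.**  Window profiles `g, g'` with `‖g m − g' m‖ ≤ B` for every `m` and `≤ β` OFF the block `[a, b]`: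
`λ Σ_{[a,b]} ‖g − g'‖² ≤ B·β·Σ'_j |j| κ j + Σ_{[a,b]} ⟪Φ m g − Φ m g', g m − g' m⟫`.  (Apply (conv) to the pair (`g` cut off to `g'`
outside the block, `g'`); the Lipschitz error of the cut-off at gap `m` is `≤ β Σ'_j κ j · [m + j ∉ [a,b]]`, and for each `j` at most `|j|`
members `m` of the block have `m + j` outside it.) -/
theorem convex_block (hκ : ∀ j, 0 ≤ κ j) (hκs : Summable κ) (hκ1 : Summable (fun j : ℤ => |(j : ℝ)| * κ j)) {lam : ℝ}
    (hconv : ∀ (F : Finset ℤ) (h h' : ℤ → E), (∀ k, h k ∈ W k) → (∀ k, h' k ∈ W k) → (∀ k, k ∉ F → h k = h' k) →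
      lam * ∑ m ∈ F, ‖h m - h' m‖ ^ 2 ≤ ∑ m ∈ F, ⟪Φ m h - Φ m h', h m - h' m⟫)
    (hlip1 : ∀ m : ℤ, ∀ h h' : ℤ → E, (∀ k, h k ∈ W k) → (∀ k, h' k ∈ W k) →
      ‖Φ m h - Φ m h'‖ ≤ ∑' j : ℤ, κ j * ‖h (m + j) - h' (m + j)‖)
    (g g' : ℤ → E) (hg : ∀ k, g k ∈ W k) (hg' : ∀ k, g' k ∈ W k) {B : ℝ} (hd : ∀ m, ‖g m - g' m‖ ≤ B)
    (a b : ℤ) {β : ℝ} (hβ0 : 0 ≤ β) (hβ : ∀ m, m ∉ Finset.Icc a b → ‖g m - g' m‖ ≤ β) :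
    lam * ∑ m ∈ Finset.Icc a b, ‖g m - g' m‖ ^ 2 ≤
      B * β * (∑' j : ℤ, |(j : ℝ)| * κ j) + ∑ m ∈ Finset.Icc a b, ⟪Φ m g - Φ m g', g m - g' m⟫ := by
  obtain ⟨F, hF⟩ : ∃ F : Finset ℤ, F = Finset.Icc a b := ⟨_, rfl⟩
  simp only [← hF] at hβ ⊢
  have hB0 : 0 ≤ B := (norm_nonneg _).trans (hd 0)
  -- the cut-off profile: `g` on the block, `g'` off it
  obtain ⟨gN, hgN⟩ : ∃ gN : ℤ → E, gN = fun k => if k ∈ F then g k else g' k := ⟨_, rfl⟩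
  have hon : ∀ k ∈ F, gN k = g k := fun k hk => by simp only [hgN, if_pos hk]
  have hoff : ∀ k, k ∉ F → gN k = g' k := fun k hk => by simp only [hgN, if_neg hk]
  have hgNW : ∀ k, gN k ∈ W k := fun k => by
    by_cases hk : k ∈ F
    · rw [hon k hk]; exact hg k
    · rw [hoff k hk]; exact hg' k
  have hdiff : ∀ k, ‖gN k - g k‖ ≤ (if k ∈ F then (0 : ℝ) else β) := fun k => by
    by_cases hk : k ∈ F
    · rw [if_pos hk, hon k hk, sub_self, norm_zero]
    · rw [if_neg hk, hoff k hk, norm_sub_rev]; exact hβ k hk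
  have hite0 : ∀ k : ℤ, 0 ≤ (if k ∈ F then (0 : ℝ) else β) := fun k => by split_ifs <;> linarith
  have hiteβ : ∀ k : ℤ, (if k ∈ F then (0 : ℝ) else β) ≤ β := fun k => by split_ifs <;> linarith
  have hdiff' : ∀ k, ‖gN k - g k‖ ≤ β := fun k => (hdiff k).trans (hiteβ k)
  -- ℓ²-monotonicity applied to the pair (cut-off profile, `g'`)
  have h0 := hconv F gN g' hgNW hg' hoff
  have h1 : ∑ m ∈ F, ‖gN m - g' m‖ ^ 2 = ∑ m ∈ F, ‖g m - g' m‖ ^ 2 :=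
    Finset.sum_congr rfl (fun m hm => by rw [hon m hm])
  have h2 : ∑ m ∈ F, ⟪Φ m gN - Φ m g', gN m - g' m⟫ =
      ∑ m ∈ F, ⟪Φ m gN - Φ m g, g m - g' m⟫ + ∑ m ∈ F, ⟪Φ m g - Φ m g', g m - g' m⟫ := by
    rw [← Finset.sum_add_distrib]
    refine Finset.sum_congr rfl (fun m hm => ?_)
    rw [hon m hm, ← inner_add_left, sub_add_sub_cancel]
  rw [h1, h2] at h0
  -- the cut-off error at gap `m`: Lipschitz bound against the indicator of «`m + j` off the block»
  have hsm : ∀ m : ℤ, Summable (fun j : ℤ => κ j * ‖gN (m + j) - g (m + j)‖) := fun m =>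
    Summable.of_nonneg_of_le (fun j => mul_nonneg (hκ j) (norm_nonneg _))
      (fun j => mul_le_mul_of_nonneg_left (hdiff' _) (hκ j)) (hκs.mul_right β)
  have hsi : ∀ m : ℤ, Summable (fun j : ℤ => κ j * (if m + j ∈ F then (0 : ℝ) else β)) := fun m =>
    Summable.of_nonneg_of_le (fun j => mul_nonneg (hκ j) (hite0 _))
      (fun j => mul_le_mul_of_nonneg_left (hiteβ _) (hκ j)) (hκs.mul_right β)
  have h3 : ∀ m ∈ F, ⟪Φ m gN - Φ m g, g m - g' m⟫ ≤ B * ∑' j : ℤ, κ j * (if m + j ∈ F then (0 : ℝ) else β) :=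
    fun m _ => by
    have h31 : ‖Φ m gN - Φ m g‖ ≤ ∑' j : ℤ, κ j * (if m + j ∈ F then (0 : ℝ) else β) :=
      (hlip1 m gN g hgNW hg).trans
        (Summable.tsum_le_tsum (fun j => mul_le_mul_of_nonneg_left (hdiff _) (hκ j)) (hsm m) (hsi m))
    have h32 : 0 ≤ ∑' j : ℤ, κ j * (if m + j ∈ F then (0 : ℝ) else β) :=
      tsum_nonneg (fun j => mul_nonneg (hκ j) (hite0 _))
    calc ⟪Φ m gN - Φ m g, g m - g' m⟫ ≤ ‖Φ m gN - Φ m g‖ * ‖g m - g' m‖ := real_inner_le_norm _ _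
      _ ≤ (∑' j : ℤ, κ j * (if m + j ∈ F then (0 : ℝ) else β)) * B := mul_le_mul h31 (hd m) (norm_nonneg _) h32
      _ = B * ∑' j : ℤ, κ j * (if m + j ∈ F then (0 : ℝ) else β) := mul_comm _ _
  -- the count: for each coupling distance `j` at most `|j|` block members are affected
  have hcount : ∀ j : ℤ, ∑ m ∈ F, κ j * (if m + j ∈ F then (0 : ℝ) else β) ≤ β * (|(j : ℝ)| * κ j) := fun j => by
    rw [← Finset.mul_sum, Finset.sum_ite, Finset.sum_const_zero, zero_add, Finset.sum_const, nsmul_eq_mul]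
    have hc := card_filter_shift_not_mem_Icc_le a b j
    rw [← hF] at hc
    calc κ j * (((F.filter (fun m => ¬ (m + j ∈ F))).card : ℝ) * β)
        = β * (((F.filter (fun m => ¬ (m + j ∈ F))).card : ℝ) * κ j) := by ring
      _ ≤ β * (|(j : ℝ)| * κ j) := mul_le_mul_of_nonneg_left (mul_le_mul_of_nonneg_right hc (hκ j)) hβ0
  have hsumL : Summable (fun j : ℤ => ∑ m ∈ F, κ j * (if m + j ∈ F then (0 : ℝ) else β)) :=
    Summable.of_nonneg_of_le (fun j => Finset.sum_nonneg (fun m _ => mul_nonneg (hκ j) (hite0 _))) hcount (hκ1.mul_left β)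
  have h4 : ∑ m ∈ F, B * ∑' j : ℤ, κ j * (if m + j ∈ F then (0 : ℝ) else β) ≤ B * (β * ∑' j : ℤ, |(j : ℝ)| * κ j) := by
    rw [← Finset.mul_sum]
    refine mul_le_mul_of_nonneg_left ?_ hB0
    rw [← Summable.tsum_finsetSum (fun m _ => hsi m), ← tsum_mul_left]
    exact Summable.tsum_le_tsum hcount hsumL (hκ1.mul_left β)
  have h5 : ∑ m ∈ F, ⟪Φ m gN - Φ m g, g m - g' m⟫ ≤ B * β * ∑' j : ℤ, |(j : ℝ)| * κ j :=
    calc ∑ m ∈ F, ⟪Φ m gN - Φ m g, g m - g' m⟫ ≤ ∑ m ∈ F, B * ∑' j : ℤ, κ j * (if m + j ∈ F then (0 : ℝ) else β) :=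
          Finset.sum_le_sum h3
      _ ≤ B * (β * ∑' j : ℤ, |(j : ℝ)| * κ j) := h4
      _ = B * β * ∑' j : ℤ, |(j : ℝ)| * κ j := by ring
  linarith

/-- the cut-off inequality with `β = B` and EQUAL stresses: a UNIFORM bound on the block sums `λ Σ_{[a,b]} ‖g − g'‖² ≤ B²·Σ'|j|κ j`. -/
theorem convex_block_bound_of_eq (hκ : ∀ j, 0 ≤ κ j) (hκs : Summable κ) (hκ1 : Summable (fun j : ℤ => |(j : ℝ)| * κ j)) {lam : ℝ}
    (hconv : ∀ (F : Finset ℤ) (h h' : ℤ → E), (∀ k, h k ∈ W k) → (∀ k, h' k ∈ W k) → (∀ k, k ∉ F → h k = h' k) →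
      lam * ∑ m ∈ F, ‖h m - h' m‖ ^ 2 ≤ ∑ m ∈ F, ⟪Φ m h - Φ m h', h m - h' m⟫)
    (hlip1 : ∀ m : ℤ, ∀ h h' : ℤ → E, (∀ k, h k ∈ W k) → (∀ k, h' k ∈ W k) →
      ‖Φ m h - Φ m h'‖ ≤ ∑' j : ℤ, κ j * ‖h (m + j) - h' (m + j)‖)
    (g g' : ℤ → E) (hg : ∀ k, g k ∈ W k) (hg' : ∀ k, g' k ∈ W k) {B : ℝ} (hd : ∀ m, ‖g m - g' m‖ ≤ B)
    (heq : ∀ m, Φ m g = Φ m g') (a b : ℤ) :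
    lam * ∑ m ∈ Finset.Icc a b, ‖g m - g' m‖ ^ 2 ≤ B * B * ∑' j : ℤ, |(j : ℝ)| * κ j := by
  have hB0 : 0 ≤ B := (norm_nonneg _).trans (hd 0)
  have h := convex_block Φ W κ hκ hκs hκ1 hconv hlip1 g g' hg hg' hd a b hB0 (fun m _ => hd m)
  have h0 : ∑ m ∈ Finset.Icc a b, ⟪Φ m g - Φ m g', g m - g' m⟫ = 0 :=
    Finset.sum_eq_zero (fun m _ => by rw [heq m, sub_self, inner_zero_left])
  linarith

/-- ★ **DISCRETE LIOUVILLE (uniqueness), ℓ²-monotone form.**  Two window profiles with BOUNDED difference and EQUAL transmitted stresses across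
every gap coincide — from (conv) with `λ > 0` and the `ℓ¹`-Lipschitz bound with finite first moment; NO dominance relation between `λ` and `κ`. -/
theorem convex_unique (hκ : ∀ j, 0 ≤ κ j) (hκs : Summable κ) (hκ1 : Summable (fun j : ℤ => |(j : ℝ)| * κ j)) {lam : ℝ}
    (hlam : 0 < lam)
    (hconv : ∀ (F : Finset ℤ) (h h' : ℤ → E), (∀ k, h k ∈ W k) → (∀ k, h' k ∈ W k) → (∀ k, k ∉ F → h k = h' k) →
      lam * ∑ m ∈ F, ‖h m - h' m‖ ^ 2 ≤ ∑ m ∈ F, ⟪Φ m h - Φ m h', h m - h' m⟫)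
    (hlip1 : ∀ m : ℤ, ∀ h h' : ℤ → E, (∀ k, h k ∈ W k) → (∀ k, h' k ∈ W k) →
      ‖Φ m h - Φ m h'‖ ≤ ∑' j : ℤ, κ j * ‖h (m + j) - h' (m + j)‖)
    (g g' : ℤ → E) (hg : ∀ k, g k ∈ W k) (hg' : ∀ k, g' k ∈ W k) {B : ℝ} (hd : ∀ m, ‖g m - g' m‖ ≤ B)
    (heq : ∀ m, Φ m g = Φ m g') : g = g' := by
  obtain ⟨K₁, hK₁⟩ : ∃ K₁ : ℝ, K₁ = ∑' j : ℤ, |(j : ℝ)| * κ j := ⟨_, rfl⟩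
  have hB0 : 0 ≤ B := (norm_nonneg _).trans (hd 0)
  have hK0 : 0 ≤ K₁ := by rw [hK₁]; exact tsum_nonneg (fun j => mul_nonneg (abs_nonneg _) (hκ j))
  -- Step 1: the uniform block bound, hence `‖g m − g' m‖ → 0`
  have hC : ∀ a b : ℤ, ∑ m ∈ Finset.Icc a b, ‖g m - g' m‖ ^ 2 ≤ B * B * K₁ / lam := fun a b => by
    rw [le_div_iff₀ hlam, mul_comm, hK₁]
    exact convex_block_bound_of_eq Φ W κ hκ hκs hκ1 hconv hlip1 g g' hg hg' hd heq a b
  funext m₀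
  rw [← sub_eq_zero, ← norm_le_zero_iff]
  -- Step 2: on a large block round `m₀` the difference is `≤ ε` off the block, so `λ‖d m₀‖² ≤ B·K₁·ε`
  have key : ∀ ε : ℝ, 0 < ε → lam * ‖g m₀ - g' m₀‖ ^ 2 ≤ B * K₁ * ε := fun ε hε => by
    obtain ⟨N, hN⟩ := eventually_small_of_block_bound (fun m => ‖g m - g' m‖) hC hε
    have hβ : ∀ m, m ∉ Finset.Icc (-((N : ℤ) + |m₀|)) ((N : ℤ) + |m₀|) → ‖g m - g' m‖ ≤ ε := fun m hm => by
      refine (hN m (lt_abs.2 ?_)).le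
      rw [Finset.mem_Icc, not_and_or, not_le, not_le] at hm
      rcases hm with hm | hm
      · exact Or.inr (by linarith [abs_nonneg m₀])
      · exact Or.inl (by linarith [abs_nonneg m₀])
    have h1 := convex_block Φ W κ hκ hκs hκ1 hconv hlip1 g g' hg hg' hd (-((N : ℤ) + |m₀|)) ((N : ℤ) + |m₀|) hε.le hβ
    have h0 : ∑ m ∈ Finset.Icc (-((N : ℤ) + |m₀|)) ((N : ℤ) + |m₀|), ⟪Φ m g - Φ m g', g m - g' m⟫ = 0 :=
      Finset.sum_eq_zero (fun m _ => by rw [heq m, sub_self, inner_zero_left])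
    have hN0 : (0 : ℤ) ≤ N := Nat.cast_nonneg N
    have hm₀ : m₀ ∈ Finset.Icc (-((N : ℤ) + |m₀|)) ((N : ℤ) + |m₀|) := by
      rw [Finset.mem_Icc]; constructor <;> linarith [neg_abs_le m₀, le_abs_self m₀]
    have h2 : ‖g m₀ - g' m₀‖ ^ 2 ≤ ∑ m ∈ Finset.Icc (-((N : ℤ) + |m₀|)) ((N : ℤ) + |m₀|), ‖g m - g' m‖ ^ 2 :=
      Finset.single_le_sum (f := fun m => ‖g m - g' m‖ ^ 2) (fun m _ => sq_nonneg _) hm₀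
    rw [← hK₁] at h1
    nlinarith [mul_le_mul_of_nonneg_left h2 hlam.le]
  -- Step 3: `ε ↓ 0`
  by_contra hne
  have ht : 0 < ‖g m₀ - g' m₀‖ := lt_of_not_ge hne
  have hL : 0 < lam * ‖g m₀ - g' m₀‖ ^ 2 := by positivity
  have h := key (lam * ‖g m₀ - g' m₀‖ ^ 2 / (2 * (B * K₁ + 1))) (by positivity)
  rw [mul_div_assoc', le_div_iff₀ (by positivity)] at h
  nlinarith [mul_nonneg (mul_nonneg hB0 hK0) hL.le]

/-- **Bounded relative offsets ⇒ EQUAL transmitted stress**, ℓ²-monotone form: constant stresses `σ, σ'` of two window profiles whose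
difference has BOUNDED BLOCK SUMS (`‖Σ_{[a,b]} (g − g')‖ ≤ D₂`, i.e. bounded relative offsets) are equal.  (The cut-off inequality with
`β = B = D₂` bounds every block sum of `‖d‖²`, so `‖d m‖ → 0`; Tannery's theorem gives `Σ'_j κ j ‖d (m+j)‖ → 0`, which dominates `‖σ − σ'‖`.) -/
theorem convex_stress_eq (hκ : ∀ j, 0 ≤ κ j) (hκs : Summable κ) (hκ1 : Summable (fun j : ℤ => |(j : ℝ)| * κ j)) {lam : ℝ}
    (hlam : 0 < lam)
    (hconv : ∀ (F : Finset ℤ) (h h' : ℤ → E), (∀ k, h k ∈ W k) → (∀ k, h' k ∈ W k) → (∀ k, k ∉ F → h k = h' k) →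
      lam * ∑ m ∈ F, ‖h m - h' m‖ ^ 2 ≤ ∑ m ∈ F, ⟪Φ m h - Φ m h', h m - h' m⟫)
    (hlip1 : ∀ m : ℤ, ∀ h h' : ℤ → E, (∀ k, h k ∈ W k) → (∀ k, h' k ∈ W k) →
      ‖Φ m h - Φ m h'‖ ≤ ∑' j : ℤ, κ j * ‖h (m + j) - h' (m + j)‖)
    (g g' : ℤ → E) (hg : ∀ k, g k ∈ W k) (hg' : ∀ k, g' k ∈ W k) {σ σ' : E} (hσ : ∀ m, Φ m g = σ) (hσ' : ∀ m, Φ m g' = σ')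
    {D₂ : ℝ} (hsum : ∀ a b : ℤ, ‖∑ m ∈ Finset.Icc a b, (g m - g' m)‖ ≤ D₂) : σ = σ' := by
  have hD0 : 0 ≤ D₂ := (norm_nonneg _).trans (hsum 0 0)
  have hd : ∀ m, ‖g m - g' m‖ ≤ D₂ := fun m => by
    have := hsum m m; rwa [Finset.Icc_self, Finset.sum_singleton] at this
  obtain ⟨K₁, hK₁⟩ : ∃ K₁ : ℝ, K₁ = ∑' j : ℤ, |(j : ℝ)| * κ j := ⟨_, rfl⟩
  -- the uniform block bound
  have hC : ∀ a b : ℤ, ∑ m ∈ Finset.Icc a b, ‖g m - g' m‖ ^ 2 ≤ (D₂ * D₂ * K₁ + ‖σ - σ'‖ * D₂) / lam := fun a b => by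
    rw [le_div_iff₀ hlam, mul_comm]
    have h := convex_block Φ W κ hκ hκs hκ1 hconv hlip1 g g' hg hg' hd a b hD0 (fun m _ => hd m)
    have h3 : ∑ m ∈ Finset.Icc a b, ⟪Φ m g - Φ m g', g m - g' m⟫ = ⟪σ - σ', ∑ m ∈ Finset.Icc a b, (g m - g' m)⟫ := by
      rw [inner_sum]; exact Finset.sum_congr rfl (fun m _ => by rw [hσ m, hσ' m])
    have h2 : ∑ m ∈ Finset.Icc a b, ⟪Φ m g - Φ m g', g m - g' m⟫ ≤ ‖σ - σ'‖ * D₂ := by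
      rw [h3]; exact (real_inner_le_norm _ _).trans (mul_le_mul_of_nonneg_left (hsum a b) (norm_nonneg _))
    rw [← hK₁] at h
    linarith
  -- Tannery: `m ↦ Σ'_j κ j ‖d (m+j)‖` tends to `0` along the cofinite filter
  have h0 : Tendsto (fun n : ℤ => ‖g n - g' n‖) cofinite (𝓝 0) := tendsto_norm_cofinite_of_block_bound (fun n => g n - g' n) hC
  have hT : Tendsto (fun m : ℤ => ∑' j : ℤ, κ j * ‖g (m + j) - g' (m + j)‖) cofinite (𝓝 (∑' _ : ℤ, (0 : ℝ))) := by
    refine tendsto_tsum_of_dominated_convergence (bound := fun j => κ j * D₂) (hκs.mul_right D₂) (fun j => ?_)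
      (Eventually.of_forall (fun m j => ?_))
    · have h1 := (h0.comp (add_left_injective j).tendsto_cofinite).const_mul (κ j)
      rw [mul_zero] at h1
      exact h1
    · rw [Real.norm_eq_abs, abs_of_nonneg (mul_nonneg (hκ j) (norm_nonneg _))]
      exact mul_le_mul_of_nonneg_left (hd _) (hκ j)
  rw [tsum_zero] at hT
  have hle : ∀ m : ℤ, ‖σ - σ'‖ ≤ ∑' j : ℤ, κ j * ‖g (m + j) - g' (m + j)‖ := fun m =>
    calc ‖σ - σ'‖ = ‖Φ m g - Φ m g'‖ := by rw [hσ, hσ']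
      _ ≤ _ := hlip1 m g g' hg hg'
  have h4 : ‖σ - σ'‖ ≤ 0 := ge_of_tendsto' hT hle
  exact sub_eq_zero.1 (norm_le_zero_iff.1 h4)

/-- ★ **ABSTRACT PS, ℓ²-monotone form = E1′ `SlavingKernelConvex` of `…ChartedPlanarOrderTubeConvex`** (windows; ℓ²-monotonicity of the whole
gap-stress map on finitely supported differences with `λ > 0`; infinite coupling range with summable weights of finite first moment; NO dominance):
two offset profiles whose increment profiles lie in the windows and are balanced (constant transmitted stress each), and whose DIFFERENCE IS
BOUNDED, differ by a translation.  Binder order = `SlavingKernelConvex`. -/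
theorem convex_translation (hκ : ∀ j, 0 ≤ κ j) (hκs : Summable κ) (hκ1 : Summable (fun j : ℤ => |(j : ℝ)| * κ j)) {lam : ℝ}
    (hlam : 0 < lam)
    (hconv : ∀ (F : Finset ℤ) (h h' : ℤ → E), (∀ k, h k ∈ W k) → (∀ k, h' k ∈ W k) → (∀ k, k ∉ F → h k = h' k) →
      lam * ∑ m ∈ F, ‖h m - h' m‖ ^ 2 ≤ ∑ m ∈ F, ⟪Φ m h - Φ m h', h m - h' m⟫)
    (hlip1 : ∀ m : ℤ, ∀ h h' : ℤ → E, (∀ k, h k ∈ W k) → (∀ k, h' k ∈ W k) →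
      ‖Φ m h - Φ m h'‖ ≤ ∑' j : ℤ, κ j * ‖h (m + j) - h' (m + j)‖)
    (w w' : ℤ → E) (hg : ∀ k, w k - w (k - 1) ∈ W k) (hg' : ∀ k, w' k - w' (k - 1) ∈ W k) (σ σ' : E)
    (hσ : ∀ m, Φ m (fun k => w k - w (k - 1)) = σ) (hσ' : ∀ m, Φ m (fun k => w' k - w' (k - 1)) = σ')
    (D : ℝ) (hD : ∀ m, ‖w m - w' m‖ ≤ D) : ∃ c : E, ∀ m, w' m = w m + c := by
  have hsum : ∀ a b : ℤ, ‖∑ m ∈ Finset.Icc a b, ((w m - w (m - 1)) - (w' m - w' (m - 1)))‖ ≤ 2 * D :=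
    norm_sum_Icc_increments_le hD
  have hσσ' : σ = σ' :=
    convex_stress_eq Φ W κ hκ hκs hκ1 hlam hconv hlip1 (fun k => w k - w (k - 1)) (fun k => w' k - w' (k - 1)) hg hg' hσ hσ' hsum
  have heq : ∀ m, Φ m (fun k => w k - w (k - 1)) = Φ m (fun k => w' k - w' (k - 1)) := fun m => by rw [hσ, hσ', hσσ']
  have hd : ∀ m, ‖(w m - w (m - 1)) - (w' m - w' (m - 1))‖ ≤ 2 * D := fun m => by
    have := hsum m m; rwa [Finset.Icc_self, Finset.sum_singleton] at this
  have hgg := convex_unique Φ W κ hκ hκs hκ1 hlam hconv hlip1 (fun k => w k - w (k - 1)) (fun k => w' k - w' (k - 1)) hg hg' hd heq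
  exact exists_translation_of_increments_eq (fun m => (congrFun hgg m).symm)

omit [InnerProductSpace ℝ E] in
/-- finitely supported functions: a sum of `‖d ·‖²` over ANY finite set is at most the sum over the support set `F`. -/
theorem sum_sq_le_sum_sq_of_support {d : ℤ → E} {F : Finset ℤ} (hF : ∀ k, k ∉ F → d k = 0) (G : Finset ℤ) :
    ∑ n ∈ G, ‖d n‖ ^ 2 ≤ ∑ n ∈ F, ‖d n‖ ^ 2 := by
  rw [← Finset.sum_filter_of_ne (s := G) (p := fun n => n ∈ F) (fun n _ hn => by
    by_contra hnF; exact hn (by rw [hF n hnF, norm_zero, zero_pow two_ne_zero]))]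
  exact Finset.sum_le_sum_of_subset_of_nonneg (fun n hn => (Finset.mem_filter.1 hn).2) (fun n _ _ => sq_nonneg _)

/-- **E1's scalar data IMPLY E1′'s convexity** (the WEAKER certificate): own-increment `λ`-strong monotonicity + the `ℓ¹`-Lipschitz bound give
ℓ²-monotonicity on finitely supported differences with constant `λ − (Σ'κ − κ 0)` (Young's inequality against the off-diagonal weights; positive
exactly under E1's dominance hypothesis). -/
theorem convex_of_mono_dom (hκ : ∀ j, 0 ≤ κ j) (hκs : Summable κ) {lam : ℝ}
    (hmono : ∀ m : ℤ, ∀ h : ℤ → E, (∀ k, h k ∈ W k) → ∀ b' ∈ W m,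
      lam * ‖h m - b'‖ ^ 2 ≤ ⟪Φ m h - Φ m (Function.update h m b'), h m - b'⟫)
    (hlip1 : ∀ m : ℤ, ∀ h h' : ℤ → E, (∀ k, h k ∈ W k) → (∀ k, h' k ∈ W k) →
      ‖Φ m h - Φ m h'‖ ≤ ∑' j : ℤ, κ j * ‖h (m + j) - h' (m + j)‖)
    (F : Finset ℤ) (h h' : ℤ → E) (hh : ∀ k, h k ∈ W k) (hh' : ∀ k, h' k ∈ W k) (hF : ∀ k, k ∉ F → h k = h' k) :
    (lam - ((∑' j, κ j) - κ 0)) * ∑ m ∈ F, ‖h m - h' m‖ ^ 2 ≤ ∑ m ∈ F, ⟪Φ m h - Φ m h', h m - h' m⟫ := by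
  -- notation-free abbreviations
  obtain ⟨d, hd⟩ : ∃ d : ℤ → E, d = fun k => h k - h' k := ⟨_, rfl⟩
  obtain ⟨ω, hω⟩ : ∃ ω : ℤ → ℝ, ω = fun j => if j = 0 then (0 : ℝ) else κ j := ⟨_, rfl⟩
  have hω0 : ∀ j, 0 ≤ ω j := fun j => by rw [hω]; exact ite_weight_nonneg hκ j
  have hωs : Summable ω := by rw [hω]; exact summable_ite_weight hκ hκs
  have hωK : ∑' j, ω j = (∑' j, κ j) - κ 0 := by rw [hω]; exact tsum_ite_weight hκs
  have hdF : ∀ k, k ∉ F → d k = 0 := fun k hk => by rw [hd]; exact sub_eq_zero.2 (hF k hk)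
  -- a uniform bound on the (finitely supported) difference
  obtain ⟨B, hB⟩ : ∃ B : ℝ, B = ∑ k ∈ F, ‖d k‖ := ⟨_, rfl⟩
  have hdB : ∀ k, ‖d k‖ ≤ B := fun k => by
    by_cases hk : k ∈ F
    · rw [hB]; exact Finset.single_le_sum (f := fun k => ‖d k‖) (fun k _ => norm_nonneg _) hk
    · rw [hdF k hk, norm_zero, hB]; exact Finset.sum_nonneg (fun k _ => norm_nonneg _)
  -- pointwise: `λ‖d m‖² − ‖d m‖·Σ' ω j ‖d (m+j)‖ ≤ ⟪Φ m h − Φ m h', d m⟫`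
  have hpt : ∀ m : ℤ, lam * ‖d m‖ ^ 2 - ‖d m‖ * ∑' j, ω j * ‖d (m + j)‖ ≤ ⟪Φ m h - Φ m h', h m - h' m⟫ := fun m => by
    have hu : ∀ k, Function.update h m (h' m) k ∈ W k := fun k => by
      by_cases hk : k = m
      · subst hk; rw [Function.update_self]; exact hh' k
      · rw [Function.update_of_ne hk]; exact hh k
    have h1 := hmono m h hh (h' m) (hh' m)
    have h2 : ‖Φ m (Function.update h m (h' m)) - Φ m h'‖ ≤ ∑' j, ω j * ‖d (m + j)‖ := by
      refine (hlip1 m _ h' hu hh').trans (le_of_eq (tsum_congr (fun j => ?_)))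
      by_cases hj : j = 0
      · simp only [hω, hj, if_pos, add_zero, Function.update_self, sub_self, norm_zero, mul_zero, zero_mul]
      · have hne : m + j ≠ m := fun hmj => hj (by linarith)
        simp only [hω, hd, if_neg hj, Function.update_of_ne hne]
    have h3 : ⟪Φ m h - Φ m h', h m - h' m⟫ = ⟪Φ m h - Φ m (Function.update h m (h' m)), h m - h' m⟫ +
        ⟪Φ m (Function.update h m (h' m)) - Φ m h', h m - h' m⟫ := by
      rw [← inner_add_left, sub_add_sub_cancel]
    have h4 : -(‖d m‖ * ∑' j, ω j * ‖d (m + j)‖) ≤ ⟪Φ m (Function.update h m (h' m)) - Φ m h', h m - h' m⟫ := by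
      have h5 := abs_real_inner_le_norm (Φ m (Function.update h m (h' m)) - Φ m h') (h m - h' m)
      rw [abs_le] at h5
      have h6 : ‖Φ m (Function.update h m (h' m)) - Φ m h'‖ * ‖h m - h' m‖ ≤ (∑' j, ω j * ‖d (m + j)‖) * ‖d m‖ := by
        rw [hd]; exact mul_le_mul_of_nonneg_right (hd ▸ h2) (norm_nonneg _)
      nlinarith [h5.1]
    have h7 : ‖d m‖ = ‖h m - h' m‖ := by rw [hd]
    rw [h7] at h4 ⊢
    linarith
  -- Young against the off-diagonal weights, summed over `F`
  have hS : ∀ m : ℤ, Summable (fun j => ω j * ‖d (m + j)‖ ^ 2) := fun m =>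
    Summable.of_nonneg_of_le (fun j => mul_nonneg (hω0 j) (sq_nonneg _))
      (fun j => mul_le_mul_of_nonneg_left (pow_le_pow_left₀ (norm_nonneg _) (hdB _) 2) (hω0 j)) (hωs.mul_right (B ^ 2))
  have hY : ∀ m : ℤ, ‖d m‖ * ∑' j, ω j * ‖d (m + j)‖ ≤
      (∑' j, ω j) / 2 * ‖d m‖ ^ 2 + 1 / 2 * ∑' j, ω j * ‖d (m + j)‖ ^ 2 := fun m =>
    mul_tsum_le_young hω0 hωs (u := fun j => ‖d (m + j)‖) (fun j => norm_nonneg _) (fun j => hdB _) (‖d m‖)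
  have hshift : ∀ j : ℤ, ∑ m ∈ F, ω j * ‖d (m + j)‖ ^ 2 ≤ ω j * ∑ n ∈ F, ‖d n‖ ^ 2 := fun j => by
    rw [← Finset.mul_sum]
    refine mul_le_mul_of_nonneg_left ?_ (hω0 j)
    rw [← Finset.sum_image (f := fun n => ‖d n‖ ^ 2) (fun x _ y _ hxy => add_right_cancel hxy)]
    exact sum_sq_le_sum_sq_of_support hdF _
  have hsum2 : ∑ m ∈ F, ∑' j, ω j * ‖d (m + j)‖ ^ 2 ≤ (∑' j, ω j) * ∑ n ∈ F, ‖d n‖ ^ 2 := by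
    rw [← Summable.tsum_finsetSum (fun m _ => hS m), ← tsum_mul_right]
    exact Summable.tsum_le_tsum hshift (summable_sum (fun m _ => hS m)) (hωs.mul_right _)
  have htot : ∑ m ∈ F, ‖d m‖ * ∑' j, ω j * ‖d (m + j)‖ ≤ (∑' j, ω j) * ∑ m ∈ F, ‖d m‖ ^ 2 :=
    calc ∑ m ∈ F, ‖d m‖ * ∑' j, ω j * ‖d (m + j)‖
        ≤ ∑ m ∈ F, ((∑' j, ω j) / 2 * ‖d m‖ ^ 2 + 1 / 2 * ∑' j, ω j * ‖d (m + j)‖ ^ 2) := Finset.sum_le_sum (fun m _ => hY m)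
      _ = (∑' j, ω j) / 2 * ∑ m ∈ F, ‖d m‖ ^ 2 + 1 / 2 * ∑ m ∈ F, ∑' j, ω j * ‖d (m + j)‖ ^ 2 := by
          rw [Finset.sum_add_distrib, Finset.mul_sum, Finset.mul_sum]
      _ ≤ (∑' j, ω j) / 2 * ∑ m ∈ F, ‖d m‖ ^ 2 + 1 / 2 * ((∑' j, ω j) * ∑ n ∈ F, ‖d n‖ ^ 2) := by linarith [hsum2]
      _ = (∑' j, ω j) * ∑ m ∈ F, ‖d m‖ ^ 2 := by ring
  have hdm : ∀ m, ‖d m‖ = ‖h m - h' m‖ := fun m => by rw [hd]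
  have hmain : ∑ m ∈ F, (lam * ‖d m‖ ^ 2 - ‖d m‖ * ∑' j, ω j * ‖d (m + j)‖) ≤ ∑ m ∈ F, ⟪Φ m h - Φ m h', h m - h' m⟫ :=
    Finset.sum_le_sum (fun m _ => hpt m)
  rw [Finset.sum_sub_distrib, ← Finset.mul_sum] at hmain
  rw [hωK] at htot
  simp only [hdm] at hmain htot
  rw [sub_mul]
  linarith

end Convex

end Summit.AtomisticToContinuum.Crystallization.Theorems.ChartedPlanarOrderTubeConvexKernel

end
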